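import Summits.NavierStokesRegularity.NavierStokesRegularity.Theorems.IntenseSetDoorsDefs
import HarnessLib

/-!
# IntenseSetDoorsTwistDefs — door S34-D «CriticalTwistDoor»: texts of record + the kernel-checked
# compositions (§6 of the door family S34 «IntenseSetDoors»; a separate module only because the 400-line
# cap forbids appending to `IntenseSetDoorsDefs.lean`)

Texts: LEAD S-door ns-s30-p1 g3's draft `HOME/ns-s30-p1/DoorD-draft-texts.lean` sha16 2d05f3f113cb1052,
ADOPTED VERBATIM by the planner of record nsreg-p1 g29 (STATUS 2026-08-28T15:22:50Z decision (1); recorded in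
ROUND-33 §8 «S34-D (seed δ′) adopted — LEAD's texts + plates»). Every declaration below is that draft's,
unchanged; `--supports stmt-NavierStokesRegularity-0056 --as helper`.

Door S34-D (purpose (a): vorticity DIRECTION relative to the velocity on the scale-critical intense set;
TYPE-FREE). With `ω = curl u`, `S_t = {x : (T − t)|ω| > ε₀}`, `X := ‖u × ω‖/‖u‖ = ‖ω‖ sin∠(u,ω)`
(`:= 0` where `u = 0`): for every `ε₀ < √3/4` there is `ε₃(ε₀) > 0` with
`‖X‖_{L³(S_t)} ≤ ε₃ (ν/(T − t))^{1/2}` for all late `t` ⇒ continuation past `T` (on the intense core the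
vorticity may be as large as it likes provided its component PERPENDICULAR TO THE VELOCITY is small in
critical `L³` — local Beltramisation). ENGINE = S34's (V34 + L34 + G34 + P2 BY NAME) + ONE new plate A34-D
(`IntenseSetDoorsAssemblyTwist`: Hölder `L⁶ × L³(S_t)` + Sobolev for `u` + Young — the Lamb pairing closes
with a MULTIPLICATIVE coefficient `(C_η²K₆²/4ν)‖X‖²_{L³(S_t)}·E` which the hypothesis turns into
`((C_ηK₆ε₃)²/4)(T − t)^{−1}·E`, merged into `a/(T − t)`, `a < 1/2`). HONEST CHECKS: the isotropic version
(`X ↦ ‖ω‖`) is IMPLIED BY DOOR C (on `S_t`, `‖ω‖^{3/2} ≤ ((T−t)/ε₀)^{3/2}‖ω‖³`); D ⊄ B, B ⊄ D (B weighs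
`‖u‖²X²` in `L¹(S_t)`, D weighs `X³`).
HONEST FRAME: a regularity CRITERION on hypothetical blow-up, Type-II-inclusive; item 0056 `NoTypeII` and
NS regularity are NOT proved; nothing here is a route or a summit statement.
-/

noncomputable section

open MeasureTheory Set Function Filter Metric Real InnerProductSpace
open _root_.Topology
open scoped ENNReal NNReal RealInnerProductSpace ContDiff
open Literature.Analysis.FluidPDE
open Summit.NavierStokesRegularity.NavierStokesRegularity.Theorems.CriticalCoherenceDoor
  (SubcriticalEnstrophyContinuation)

set_option linter.dupNamespace false

namespace Summit.NavierStokesRegularity.NavierStokesRegularity.Theorems.IntenseSetDoors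

-- nested operator types (second derivatives)
set_option maxSynthPendingDepth 3

/-! ## §6 Door S34-D «CriticalTwistDoor» -/

/-- support (definition): the CRITICAL TWIST hypothesis on `[t₀, T)`: for every `t ∈ [t₀, T)`,
`∫_{S_t} (‖u × ω‖/‖u‖)³ dx ≤ (ε₃ √(ν/(T − t)))³` on the intense set `S_t = {x : (T − t)|ω(x,t)| > ε₀}`
(`‖u × ω‖/‖u‖ = ‖ω‖ sin∠(u,ω)` is the vorticity component perpendicular to the velocity, `:= 0` where
`u = 0`; `L³` of a vorticity is scale-critical with the self-similar rate `(ν/(T − t))^{1/2}`). -/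
def CriticalTwist (u : ℝ → (EuclideanSpace ℝ (Fin 3)) → (EuclideanSpace ℝ (Fin 3)))
    (ν T t₀ ε₀ ε₃ : ℝ) : Prop :=
  ∀ t ∈ Ico t₀ T,
    (∫⁻ x in {x | ε₀ < (T - t) * ‖curl (u t) x‖},
        ENNReal.ofReal ((‖cross (u t x) (curl (u t) x)‖ / ‖u t x‖) ^ 3)) ≤
      ENNReal.ofReal ((ε₃ * Real.sqrt (ν / (T - t))) ^ 3)

/-- door S34-D «CriticalTwistDoor» (regularity criterion; type-free). For every `0 < ε₀ < √3/4`
there is `ε₃ > 0` (depending on `ε₀` only) such that: for `ν > 0`, `0 ≤ t₀ < T` and a classical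
unforced Navier–Stokes solution `(u, p)` on `ℝ³ × [0, T)` with all `L²` Sobolev seminorms bounded on
every `[0, T'']`, `T'' < T` (the frame of `CriticalCoherenceDoor`), `CriticalTwist u ν T t₀ ε₀ ε₃`
implies that `u` continues in the Sobolev class past `T`: on the intense core the vorticity may be
as large as it likes provided its component PERPENDICULAR TO THE VELOCITY is `ε₃`-small in critical
`L³` (local Beltramisation); the isotropic version (`‖ω‖` in place of `‖ω‖ sin∠(u,ω)`) is implied by
door C. -/
def CriticalTwistDoor : Prop :=
  ∀ (ε₀ : ℝ), 0 < ε₀ → ε₀ < Real.sqrt 3 / 4 → ∃ ε₃ : ℝ, 0 < ε₃ ∧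
    ∀ (ν T t₀ : ℝ), 0 < ν → 0 ≤ t₀ → t₀ < T →
    ∀ (u : ℝ → (EuclideanSpace ℝ (Fin 3)) → (EuclideanSpace ℝ (Fin 3)))
      (p : ℝ → (EuclideanSpace ℝ (Fin 3)) → ℝ),
      IsClassicalNSSolutionOn (Ico 0 T) ν 0 u p →
      (∀ T'' < T, HasBoundedSobolevNormsOn (Icc 0 T'') u) →
      CriticalTwist u ν T t₀ ε₀ ε₃ →
      HasSobolevExtensionPast ν u T

/-- plate P1-D «CriticalTwistPowerBound» (M; the content of door D). Same quantifier prefix; the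
Dirichlet integral grows at most like a SUB-LERAY power: `∫|∇u(t)|²_F ≤ K (T − t)^{−a}` on `[t₀, T)`
with `K ≥ 0`, `a < 1/2`. Print proof = V34 + L34 + Hölder `L⁶ × L³(S_t)` + Sobolev + Young (the
coefficient is MULTIPLICATIVE and merges into `a/(T − t)`) + G34 (`β = 0`), see
`CriticalTwistPowerBoundAssembly`. -/
def CriticalTwistPowerBound : Prop :=
  ∀ (ε₀ : ℝ), 0 < ε₀ → ε₀ < Real.sqrt 3 / 4 → ∃ ε₃ : ℝ, 0 < ε₃ ∧
    ∀ (ν T t₀ : ℝ), 0 < ν → 0 ≤ t₀ → t₀ < T →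
    ∀ (u : ℝ → (EuclideanSpace ℝ (Fin 3)) → (EuclideanSpace ℝ (Fin 3)))
      (p : ℝ → (EuclideanSpace ℝ (Fin 3)) → ℝ),
      IsClassicalNSSolutionOn (Ico 0 T) ν 0 u p →
      (∀ T'' < T, HasBoundedSobolevNormsOn (Icc 0 T'') u) →
      CriticalTwist u ν T t₀ ε₀ ε₃ →
      ∃ K a : ℝ, 0 ≤ K ∧ a < 1 / 2 ∧ ∀ t ∈ Ico t₀ T,
        (∫⁻ x, ENNReal.ofReal (frobeniusNormSq (fderiv ℝ (u t) x))) ≤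
          ENNReal.ofReal (K * (T - t) ^ (-a))

/-- composition (kernel-checked): P1-D and S33's P2 give door D. -/
theorem criticalTwistDoor_of (h₁ : CriticalTwistPowerBound) (h₂ : SubcriticalEnstrophyContinuation) :
    CriticalTwistDoor := by
  intro ε₀ hε₀ hε₀'
  obtain ⟨ε₃, hε₃, h⟩ := h₁ ε₀ hε₀ hε₀'
  refine ⟨ε₃, hε₃, ?_⟩
  intro ν T t₀ hν ht₀ ht₀T u p hsol hreg htw
  obtain ⟨K, a, -, ha, hF⟩ := h ν T t₀ hν ht₀ ht₀T u p hsol hreg htw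
  exact h₂ ν T t₀ K a hν ht₀ ht₀T ha u p hsol hreg hF

/-- plate A34-D «CriticalTwistPowerBoundAssembly» (M, glue). V34 + L34 + G34 ⇒ P1-D. Given `ε₀`, put
`η := (√3/(4ε₀) − 1)/2 > 0`, `a₀ := (2/√3)(1+η)ε₀ < 1/2`, take `C = C_η` from L34 and the Sobolev
constant `K₆`, and `ε₃ := √(1/2 − a₀)/(C K₆ + 1)`. At each `t ∈ [t₀, T)` with `L := ε₀/(T − t)`:
stretching `≤ (a₀/(T − t))∫|ω|² + C‖∇ω‖₂‖u × ω‖_{L²(S_t)}`; pointwise `‖u × ω‖ ≤ ‖u‖ X`,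
`X = ‖u × ω‖/‖u‖`; Hölder `(3, 3/2)` on `S_t` for `‖u‖² X²` + Sobolev for `u`:
`‖u × ω‖²_{L²(S_t)} ≤ K₆² (∫|∇u|²) ‖X‖²_{L³(S_t)} ≤ K₆² ε₃² (ν/(T − t)) ∫|ω|²`; Young:
`C‖∇ω‖₂‖u × ω‖_{L²(S_t)} ≤ ν∫|∇ω|²_F + ((C K₆ ε₃)²/4)(T − t)^{−1}∫|ω|²`; so the stretching inequality
of G34 holds with `a := a₀ + (C K₆ ε₃)²/4 < 1/2`, `β = 0`; then G34, output conversion, time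
translation as in A34-A. -/
def CriticalTwistPowerBoundAssembly : Prop :=
  ValueCutoffLowStretching → LambPairingBound → ForcedPowerGronwallSlab → CriticalTwistPowerBound

/-- composition (kernel-checked): the plates give door D. -/
theorem criticalTwistDoor_of_plates (hV : ValueCutoffLowStretching) (hL : LambPairingBound)
    (hG : ForcedPowerGronwallSlab) (hA : CriticalTwistPowerBoundAssembly)
    (h₂ : SubcriticalEnstrophyContinuation) : CriticalTwistDoor :=
  criticalTwistDoor_of (hA hV hL hG) h₂

end Summit.NavierStokesRegularity.NavierStokesRegularity.Theorems.IntenseSetDoors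

end
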